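import Literature.Topology.FourManifolds.DehnSurgeryTwistProofs
import Literature.Topology.FourManifolds.CircleAngleLift
import Literature.Topology.FourManifolds.CircleDiffeotopyProofs
import Literature.Topology.FourManifolds.GluckTwistFibre
import HarnessLib

/-!
# Rotation fields along a knot: the degree and the angle; iterated twists of a tubular neighbourhood

Topic `Literature/Topology/FourManifolds`; second file of the proof of the named fact
`Literature.Topology.FourManifolds.nonempty_diffeomorph_of_isIntegralSurgery` (`DehnSurgery.lean`:
uniqueness of integral Dehn surgery; Gompf–Stipsicz, *4-Manifolds and Kirby Calculus* (1999),
§4.5 and §5.3; Rolfsen, *Knots and Links* (1976), §9.F). Everything here is proved; no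
definition and no named fact is introduced.

The uniqueness of tubular neighbourhoods of a knot `K ⊆ S³`
(`Literature.Topology.FourManifolds.Link.exists_diffeomorph_tubularNbhd'`, `LinkTubularUniqueness.lean`)
matches two oriented tubular neighbourhoods after an ambient diffeomorphism *up to a rotation of
the fibres* by a smooth **rotation field** `u : 𝕊¹ → 𝕊¹`: `w ↦ w₀ u(x) + w₁ J u(x)` (complex
multiplication by `u x`). This file analyses such fields:

* `Literature.Topology.FourManifolds.exists_contMDiff_circle_of_periodic` — a smooth `2π`-periodic function on `ℝ`
  descends to a smooth function on the circle (local smooth angle functions,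
  `exists_angle_contMDiffAt` of `CircleDiffeotopyProofs.lean`);
* `Literature.Topology.FourManifolds.exists_int_angle_of_rotationField` — **a smooth rotation field is a power of the
  tautological field times a null-homotopic one**: for smooth `u : 𝕊¹ → 𝕊¹` there are an integer
  `d` (the degree of `u`) and a smooth angle function `β : 𝕊¹ → ℝ` with
  `R(-β x) (w₀ u(x) + w₁ J u(x)) = R(d θ) w` for `x = (cos θ, sin θ)` — the lift
  `u (cos θ, sin θ) = (cos α θ, sin α θ)`, `α (θ + 2π) = α θ + 2π d` of `CircleAngleLift.lean`
  (`exists_contDiff_angle_periodic`), with `β` the descent of the periodic part `α θ - d θ`;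
* `Literature.Topology.FourManifolds.Knot.TubularNbhd.exists_twist_int` — the **`d`-fold twist**, `d ∈ ℤ`: an oriented
  tubular neighbourhood `ν'` of the same knot with `ν' (x, w) = ν (x, R(d θ) w)` over
  `x = (cos θ, sin θ)` and `ν.HasFraming m → ν'.HasFraming (m + d)` (`Knot.TubularNbhd.twist` of
  `DehnSurgeryTwistProofs.lean` iterated `|d|` times: `iterate_twist_apply_circlePoint`,
  `HasFraming.iterate_twist`; Gompf–Stipsicz (1999), §4.5: the framings of a knot form a
  `ℤ`-torsor under the twists).

In the uniqueness of Dehn surgery these combine as follows: after the fibre twist by `-β` the two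
tubular neighbourhoods differ by the `d`-fold twist, whose framing is shifted by `d`; equality of
the framings then forces `d = 0`.

## References

* R. E. Gompf, A. I. Stipsicz, *4-Manifolds and Kirby Calculus*, GSM 20 (1999), §4.5.
  [cite: GompfStipsicz1999, §4.5]
* D. Rolfsen, *Knots and Links*, Publish or Perish (1976), §9.F. [cite: Rolfsen1976, §9.F]
* M. P. do Carmo, *Differential Geometry of Curves and Surfaces* (1976), §5.7, Lemma 1 (smooth
  angle functions). [folklore]

## Design notes

* No local notation and no local instances are declared (`𝕊ⁿ` is written
  `Metric.sphere (0 : EuclideanSpace ℝ (Fin (n + 1))) 1`); the `Fact (finrank ℝ ℝ² = 1 + 1)`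
  needed by `contMDiff_coe_sphere` is introduced inside proofs (`fact_finrank_euclideanSpace_two`).
* The two quarter turns of the tree, `quarterRot` (`DehnSurgeryTwistProofs.lean`) and `quarterTurn`
  (`GluckTwistFibre.lean`), agree (`quarterRot_eq_quarterTurn`), so that `fibreRot σ (cos θ, sin θ)`
  is the rotation `rotPlane (σ θ)` for `σ = ±1` (`fibreRot_circlePoint_eq_rotPlane`).
* No declaration in this file uses `sorry`.
-/

noncomputable section

open scoped Manifold ContDiff Topology
open Function Set

namespace Literature.Topology.FourManifolds

/-! ### Descending periodic functions to the circle -/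

/-- A periodic function takes the same value at two angles of the same point of the circle.
[folklore] -/
theorem periodic_apply_eq_of_circlePoint_eq {β₀ : ℝ → ℝ} (hβ : Periodic β₀ (2 * Real.pi))
    {s t : ℝ} (h : circlePoint s = circlePoint t) : β₀ s = β₀ t := by
  obtain ⟨k, rfl⟩ := exists_eq_add_of_circlePoint_eq h
  exact hβ.int_mul k t

/-- **Smooth periodic functions descend to smooth functions on the circle**: for a `C^∞`
`2π`-periodic `β₀ : ℝ → ℝ` there is a `C^∞` function `β : 𝕊¹ → ℝ` with `β (cos θ, sin θ) = β₀ θ`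
(take `β u = β₀ (an angle of u)`; near each point of the circle this is `β₀ ∘ L` for a smooth
local angle function `L`, `exists_angle_contMDiffAt` of `CircleDiffeotopyProofs.lean`). [folklore] -/
theorem exists_contMDiff_circle_of_periodic {β₀ : ℝ → ℝ} (hβ : Periodic β₀ (2 * Real.pi))
    (hs : ContDiff ℝ ∞ β₀) :
    ∃ β : Metric.sphere (0 : EuclideanSpace ℝ (Fin 2)) 1 → ℝ,
      ContMDiff (𝓡 1) 𝓘(ℝ, ℝ) ∞ β ∧ ∀ θ, β (circlePoint θ) = β₀ θ := by
  refine ⟨fun u => β₀ (2 * Real.pi * angA u), fun u₀ => ?_, fun θ =>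
    periodic_apply_eq_of_circlePoint_eq hβ (circlePoint_two_pi_mul_angA (circlePoint θ))⟩
  obtain ⟨L, hL, hLcp⟩ := exists_angle_contMDiffAt u₀
  have heq : (fun u => β₀ (2 * Real.pi * angA u)) = β₀ ∘ L := funext fun u =>
    periodic_apply_eq_of_circlePoint_eq hβ ((circlePoint_two_pi_mul_angA u).trans (hLcp u).symm)
  rw [heq]
  exact hs.contDiffAt.comp_contMDiffAt hL

/-! ### Rotations of the plane: `fibreRot` versus `rotPlane` -/

/-- The two quarter turns of the tree agree: `quarterRot = quarterTurn` (`(w₀, w₁) ↦ (-w₁, w₀)`).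
[folklore] -/
theorem quarterRot_eq_quarterTurn (w : EuclideanSpace ℝ (Fin 2)) : quarterRot w = quarterTurn w := by
  ext i
  fin_cases i <;> simp [quarterTurn]

/-- For `σ = ±1`, the fibre rotation `fibreRot σ (cos θ, sin θ)` of `DehnSurgeryTwistProofs.lean` is
the rotation of the plane through the angle `σ θ`. [folklore] -/
theorem fibreRot_circlePoint_eq_rotPlane {σ : ℝ} (hσ : σ = 1 ∨ σ = -1) (θ : ℝ)
    (w : EuclideanSpace ℝ (Fin 2)) :
    fibreRot σ ((circlePoint θ : Metric.sphere (0 : EuclideanSpace ℝ (Fin 2)) 1) :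
      EuclideanSpace ℝ (Fin 2)) w = rotPlane (σ * θ) w := by
  ext i
  fin_cases i
  · rcases hσ with rfl | rfl
    · simp [fibreRot_apply_zero, circlePoint_apply_zero, circlePoint_apply_one]
    · simp [fibreRot_apply_zero, circlePoint_apply_zero, circlePoint_apply_one, Real.cos_neg,
        Real.sin_neg]
  · rcases hσ with rfl | rfl
    · simp [fibreRot_apply_one, circlePoint_apply_zero, circlePoint_apply_one]
    · simp [fibreRot_apply_one, circlePoint_apply_zero, circlePoint_apply_one, Real.cos_neg,
        Real.sin_neg]

/-- Iterating the fibre rotation over `(cos θ, sin θ)` `n` times rotates through `n σ θ`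
(`σ = ±1`). [folklore] -/
theorem iterate_fibreRot_circlePoint {σ : ℝ} (hσ : σ = 1 ∨ σ = -1) (θ : ℝ) (n : ℕ)
    (w : EuclideanSpace ℝ (Fin 2)) :
    (fibreRot σ ((circlePoint θ : Metric.sphere (0 : EuclideanSpace ℝ (Fin 2)) 1) :
      EuclideanSpace ℝ (Fin 2)))^[n] w = rotPlane (n * (σ * θ)) w := by
  induction n with
  | zero => simp [rotPlane_zero]
  | succ n ih =>
    rw [iterate_succ_apply', ih, fibreRot_circlePoint_eq_rotPlane hσ, ← rotPlane_add]
    congr 1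
    push_cast
    ring

/-- The complex multiplication `w ↦ w₀ u + w₁ J u` by a unit vector `u = (cos a, sin a)` is the
rotation through `a` (restatement of the tree's `rotPlane_eq_of_cos_sin`). [folklore] -/
theorem smul_add_smul_quarterTurn_circlePoint (a : ℝ) (w : EuclideanSpace ℝ (Fin 2)) :
    w 0 • ((circlePoint a : Metric.sphere (0 : EuclideanSpace ℝ (Fin 2)) 1) : EuclideanSpace ℝ (Fin 2)) +
      w 1 • quarterTurn ((circlePoint a : Metric.sphere (0 : EuclideanSpace ℝ (Fin 2)) 1) :
        EuclideanSpace ℝ (Fin 2)) = rotPlane a w :=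
  (rotPlane_eq_of_cos_sin (circlePoint_apply_zero a) (circlePoint_apply_one a) w).symm

/-! ### The degree and the angle of a smooth rotation field -/

/-- The squared norm of a vector of `ℝ²` in coordinates. [folklore] -/
theorem norm_sq_eq_add_sq (v : EuclideanSpace ℝ (Fin 2)) : ‖v‖ ^ 2 = v 0 ^ 2 + v 1 ^ 2 := by
  rw [EuclideanSpace.norm_eq, Real.sq_sqrt (Finset.sum_nonneg fun _ _ ↦ sq_nonneg _),
    Fin.sum_univ_two, Real.norm_eq_abs, Real.norm_eq_abs, sq_abs, sq_abs]

/-- A smooth self-map of the circle read along `θ ↦ (cos θ, sin θ)` is a smooth curve in `ℝ²`.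
[folklore] -/
theorem contDiff_coe_comp_circlePoint {u : Metric.sphere (0 : EuclideanSpace ℝ (Fin 2)) 1 →
      Metric.sphere (0 : EuclideanSpace ℝ (Fin 2)) 1} (hu : ContMDiff (𝓡 1) (𝓡 1) ∞ u) :
    ContDiff ℝ ∞ fun θ : ℝ => ((u (circlePoint θ) : Metric.sphere (0 : EuclideanSpace ℝ (Fin 2)) 1) :
      EuclideanSpace ℝ (Fin 2)) := by
  haveI := fact_finrank_euclideanSpace_two
  rw [← contMDiff_iff_contDiff]
  exact contMDiff_coe_sphere.comp (hu.comp contMDiff_circlePoint)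

/-- **The degree and the angle of a smooth rotation field.** For every smooth `u : 𝕊¹ → 𝕊¹`
there are an integer `d` (the degree of `u`) and a smooth function `β : 𝕊¹ → ℝ` such that, for
`x = (cos θ, sin θ)` and all `w ∈ ℝ²`, undoing the rotation by `β x` after the complex
multiplication by `u x` leaves the rotation through `d θ`:
`R(-β x) (w₀ u(x) + w₁ J u(x)) = R(d θ) w`. Proof: lift `u (cos θ, sin θ) = (cos α θ, sin α θ)` with
`α` smooth and `α (θ + 2π) = α θ + 2π d` (`exists_contDiff_angle_periodic`; do Carmo (1976), §5.7,
Lemma 1), and descend the `2π`-periodic `α θ - d θ` to `β`. Gompf–Stipsicz (1999), §4.5 (framings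
differ by maps `S¹ → SO(2)`, classified by the degree). [cite: GompfStipsicz1999, §4.5] -/
theorem exists_int_angle_of_rotationField {u : Metric.sphere (0 : EuclideanSpace ℝ (Fin 2)) 1 →
      Metric.sphere (0 : EuclideanSpace ℝ (Fin 2)) 1} (hu : ContMDiff (𝓡 1) (𝓡 1) ∞ u) :
    ∃ (d : ℤ) (β : Metric.sphere (0 : EuclideanSpace ℝ (Fin 2)) 1 → ℝ),
      ContMDiff (𝓡 1) 𝓘(ℝ, ℝ) ∞ β ∧
      ∀ (θ : ℝ) (w : EuclideanSpace ℝ (Fin 2)),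
        rotPlane (-β (circlePoint θ))
          (w 0 • ((u (circlePoint θ) : Metric.sphere (0 : EuclideanSpace ℝ (Fin 2)) 1) :
              EuclideanSpace ℝ (Fin 2)) +
            w 1 • quarterTurn ((u (circlePoint θ) : Metric.sphere (0 : EuclideanSpace ℝ (Fin 2)) 1) :
              EuclideanSpace ℝ (Fin 2))) = rotPlane (d * θ) w := by
  -- the two coordinates of the curve `θ ↦ u (cos θ, sin θ)`
  set c : ℝ → ℝ := fun θ => ((u (circlePoint θ) : Metric.sphere (0 : EuclideanSpace ℝ (Fin 2)) 1) :
    EuclideanSpace ℝ (Fin 2)) 0 with hc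
  set s : ℝ → ℝ := fun θ => ((u (circlePoint θ) : Metric.sphere (0 : EuclideanSpace ℝ (Fin 2)) 1) :
    EuclideanSpace ℝ (Fin 2)) 1 with hs
  have hcu := contDiff_coe_comp_circlePoint hu
  have hcs : ContDiff ℝ ∞ c := contDiff_euclidean.1 hcu 0
  have hss : ContDiff ℝ ∞ s := contDiff_euclidean.1 hcu 1
  have h1 : ∀ θ, c θ ^ 2 + s θ ^ 2 = 1 := fun θ => by
    rw [hc, hs, ← norm_sq_eq_add_sq, norm_eq_of_mem_sphere, one_pow]
  have hcT : Periodic c (2 * Real.pi) := fun θ => by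
    simp only [hc, circlePoint_add_two_pi]
  have hsT : Periodic s (2 * Real.pi) := fun θ => by
    simp only [hs, circlePoint_add_two_pi]
  obtain ⟨α, d, hα, hcos, hsin, hper⟩ := exists_contDiff_angle_periodic hcs hss h1 hcT hsT
  -- the periodic part of the lift and its descent
  set β₀ : ℝ → ℝ := fun θ => α θ - d * θ with hβ₀
  have hβ₀T : Periodic β₀ (2 * Real.pi) := fun θ => by
    simp only [hβ₀, hper]
    ring
  have hβ₀s : ContDiff ℝ ∞ β₀ := hα.sub (contDiff_const.mul contDiff_id)
  obtain ⟨β, hβ, hβθ⟩ := exists_contMDiff_circle_of_periodic hβ₀T hβ₀s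
  refine ⟨d, β, hβ, fun θ w => ?_⟩
  -- `u (cos θ, sin θ) = (cos α θ, sin α θ)`, so the complex multiplication is `R(α θ)`
  have hux : u (circlePoint θ) = circlePoint (α θ) := by
    apply Subtype.ext
    ext i
    fin_cases i
    · exact (hcos θ).symm
    · exact (hsin θ).symm
  rw [hβθ, hux, smul_add_smul_quarterTurn_circlePoint, ← rotPlane_add]
  congr 1
  simp only [hβ₀]
  ring

/-! ### Iterated twists of a tubular neighbourhood and their framings -/

namespace Knot.TubularNbhd

/-- **The `n`-fold twist on points**: iterating `Knot.TubularNbhd.twist σ` `n` times rotates the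
fibre over `(cos θ, sin θ)` through `n σ θ` (`σ = ±1`). [folklore] -/
theorem iterate_twist_apply_circlePoint
    {K : Metric.sphere (0 : EuclideanSpace ℝ (Fin 2)) 1 → Metric.sphere (0 : EuclideanSpace ℝ (Fin 4)) 1}
    (ν : Knot.TubularNbhd K) (σ : ℝ) (hσ : σ ^ 2 = 1) (n : ℕ) (θ : ℝ) (w : EuclideanSpace ℝ (Fin 2)) :
    ((fun ν' : Knot.TubularNbhd K => ν'.twist σ hσ)^[n] ν) (circlePoint θ, w) =
      ν (circlePoint θ, rotPlane (n * (σ * θ)) w) := by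
  rw [← iterate_fibreRot_circlePoint (eq_one_or_eq_neg_one_of_sq hσ)]
  induction n generalizing w with
  | zero => rfl
  | succ n ih =>
    rw [iterate_succ_apply', twist_apply, ih]
    simp only [iterate_succ_apply]

/-- **The framing of the `n`-fold twist**: if `ν` has framing `m` then the `n`-fold twist
`twist σ` iterated has framing `m + n k`, where `k = σ ∈ {1, -1}` as an integer (`HasFraming.twist`
iterated). Gompf–Stipsicz (1999), §4.5; Rolfsen (1976), §9.F. [cite: GompfStipsicz1999, §4.5] -/
theorem HasFraming.iterate_twist {K : Knot} (ν : Knot.TubularNbhd K) (σ : ℝ) (hσ : σ ^ 2 = 1)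
    {m : ℤ} (h : ν.HasFraming m) {k : ℤ} (hk : (k : ℝ) = σ) (n : ℕ) :
    ((fun ν' : Knot.TubularNbhd K => ν'.twist σ hσ)^[n] ν).HasFraming (m + n * k) := by
  induction n with
  | zero => simpa using h
  | succ n ih =>
    rw [iterate_succ_apply']
    have e : m + ((n + 1 : ℕ) : ℤ) * k = m + (n : ℤ) * k + k := by
      push_cast
      ring
    rw [e]
    exact HasFraming.twist _ σ hσ ih hk

/-- **The `d`-fold twist of a tubular neighbourhood, `d ∈ ℤ`.** For every oriented tubular
neighbourhood `ν` of a knot `K` and every integer `d` there is an oriented tubular neighbourhood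
`ν'` of `K` whose fibre over `(cos θ, sin θ)` is that of `ν` rotated through `d θ`,
`ν' ((cos θ, sin θ), w) = ν ((cos θ, sin θ), R(d θ) w)`, and whose framing is that of `ν` shifted by
`d`: `ν.HasFraming m → ν'.HasFraming (m + d)` — the `|d|`-fold iterate of `Knot.TubularNbhd.twist (sign d)`
(`DehnSurgeryTwistProofs.lean`). Gompf–Stipsicz (1999), §4.5 (the framings of a knot form a
`ℤ`-torsor under the twists `(x, w) ↦ (x, xᵈ · w)`); Rolfsen (1976), §9.F.
[cite: GompfStipsicz1999, §4.5] -/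
theorem exists_twist_int {K : Knot} (ν : Knot.TubularNbhd K) (d : ℤ) :
    ∃ ν' : Knot.TubularNbhd K,
      (∀ (θ : ℝ) (w : EuclideanSpace ℝ (Fin 2)),
        ν' (circlePoint θ, w) = ν (circlePoint θ, rotPlane (d * θ) w)) ∧
      ∀ m : ℤ, ν.HasFraming m → ν'.HasFraming (m + d) := by
  obtain ⟨n, rfl | rfl⟩ := Int.eq_nat_or_neg d
  · refine ⟨(fun ν' : Knot.TubularNbhd K => ν'.twist 1 (by norm_num))^[n] ν, fun θ w => ?_,
      fun m h => ?_⟩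
    · rw [iterate_twist_apply_circlePoint, one_mul, Int.cast_natCast]
    · simpa using HasFraming.iterate_twist ν 1 (by norm_num) h (k := 1) (by norm_num) n
  · refine ⟨(fun ν' : Knot.TubularNbhd K => ν'.twist (-1) (by norm_num))^[n] ν, fun θ w => ?_,
      fun m h => ?_⟩
    · rw [iterate_twist_apply_circlePoint, Int.cast_neg, Int.cast_natCast, neg_one_mul, mul_neg, neg_mul]
    · simpa using HasFraming.iterate_twist ν (-1) (by norm_num) h (k := -1) (by norm_num) n

end Knot.TubularNbhd

end Literature.Topology.FourManifolds
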